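import Summits.QuantumFields.BalabanUV.T4Continuum.Spine.NE7.QLaBlockAvgPrintKind
import Summits.QuantumFields.BalabanUV.T4Continuum.Spine.NE7.QLaBlockAvgTwoLevelContraction

/-!
# Spine/NE7/QLaBlockAvgTwoLevelPrintKind — NODE S's averaging-side certificates ON PRINT-KIND DOMAINS for the TWO-LEVEL printed
# prescription [Balaban1987RG1] (0.10)–(0.12) `blockAvg₂ federbushSU expMeanLogSU` on `SU(N)`, and for the headline's FULL printed
# class `D.IsPrintedAveraged` (both disjuncts) — base `L` per level, not `71|S_d|ℓ`

Cell `pub-balaban-gaps` (YM blitz Y1, track G2, seat `ne7`, generation 14); text of record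
`run/shared/lean/pub/pub-balaban-gaps/ne/NE7.md` (census row R61 and its successor row of this generation).  Fifty-second
`Spine/NE7/` file; sequel of `QLaBlockAvgPrintKind` (file 51); 0 sorry; [folklore] bookkeeping over generation 8's estimates.

WHAT.  File 51 upgraded generation 8's one-level certificates (`QLaBlockAvgContraction`, domains shrinking by `16ℓ` per level) to
PRINT-KIND sup-ball domains (shrink factor `L` per level, the base of [Balaban1985Averaging] (158)) by the sharp sup growth
`dist1 F(V)(c) ≤ Lρ + Cρ²` and the generic base-`L` bootstrap `geomRad_step`.  This file does the same for the TWO-LEVEL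
prescription of generation 8's `QLaBlockAvgTwoLevelContraction` (domains `dom₂`, shrink factor `71|S_d|ℓ = 17040·L` at `(4,3)`):
§1 the sharp sup growth of the framed two-level map, `dist1 F₂(V)(c) ≤ Lρ + 23478|S_d|²ℓ²ρ²` (from generation 8's own
second-order estimate `dist1_framed₂_le`: first order = the mean transported-bond mass `≤ Lρ`; remainder `rem₂ ≤ 7|S_d|ℓρ`);
§2 the print-kind radii `radPK₂ = geomRad (ρ⋆₂∕2)` (top radius `ρ⋆₂` unchanged, `dom₂ ⊆ domPK₂`, the quadratic coefficient is small
by generation 8's `ρ⋆₂ ≤ θ∕(2K₂)`, `K₂ = 46956d|S_d|²ℓ² = 2·23478·d|S_d|²ℓ²`); §3 the tower (`FlatStepContraction`, factors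
`θ + K₂ρ_j` composing to `e·θⁿ`, `BondDevBound` ∕ `HolDevBound` (e, θ = L^{1−d}) ∕ `LoopDefectBound` (e²∕2)); §4 the HEADLINE's
class: `holDevBound_of_isPrintedAveraged₁_printKind` ∕ `₂` and, on the common print-kind family `domPrintedPK = domPK ∩ domPK₂`
(sup-balls of radius `≥ (min(ρ⋆,ρ⋆₂)∕2)·L^{−(m+K−j)}`, containing generation 8's `domPrinted`), `holDevBound_of_isPrintedAveraged_printKind`
and `loopDefectBound_of_isPrintedAveraged_printKind` for EVERY datum of the headline `continuumYM4_torus_of_BetaPertH`'s class and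
every cutoff — generation 8's full-class statements being corollaries (`HolDevBound.anti`, `domPrinted_subset_domPrintedPK`).

CENSUS EFFECT (words unchanged, R10): with file 51, census R61's located caveat («the gen-8 certificate domains are SMALLER IN KIND
than (158)'s») is discharged for the WHOLE printed class `IsPrintedAveraged` in the flat-reference form NODE S consumes; what row
O3c keeps is the two-configuration NE1a-STEP (Lipschitz form) and Bałaban's (52)∕(158) conditions verbatim — not NE7-own.  Nothing
on Bałaban's densities, `R`-operation or (1.100) insert.  (QL-a) NOT IN PRINT ([Balaban1989LargeFieldII] p. 356); NE7 NOT proved;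
spine 0∕9; one fixed finite T⁴ — NOT ℝ⁴, NOT infinite volume, NOT a mass gap, NOT Clay.
-/

noncomputable section
open Finset
open scoped BigOperators Matrix Matrix.Norms.L2Operator

namespace Summit.QuantumFields.BalabanUV.T4Continuum.Spine.NE7

open Literature.MathematicalPhysics.QuantumFieldTheory.Balaban1983to89
open Literature.MathematicalPhysics.QuantumFieldTheory.Balaban1983to89.T4Continuum
open Literature.MathematicalPhysics.QuantumFieldTheory.Balaban1983to89.T4AvgSensitivity
open Literature.MathematicalPhysics.QuantumFieldTheory.Balaban1983to89.T4AvgDerivBound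
open Literature.MathematicalPhysics.QuantumFieldTheory.Balaban1983to89.BlockAveraging (Idx off blockAvg)
open Literature.MathematicalPhysics.QuantumFieldTheory.Balaban1983to89.BlockAveragingTwoLevel (Pt blockAvg₂)
open ExpMeanLog FederbushMean

section SUN

variable {n : Type*} [Fintype n] [DecidableEq n] [Nonempty n]
variable {P : Params} {j : ℕ}

/-! ## §1 The sharp sup bound for the framed two-level map -/

/-- **SHARP PER-BOND SUP BOUND FOR THE FRAMED TWO-LEVEL MAP** [Balaban1987RG1] (0.10)–(0.12) on `SU(N)`: on the sup-ball
`dist1 V_b ≤ ρ` (guards `2ℓρ < δ_Fed`, `12|S_d|ℓρ < δ_N`, `12|S_d|ℓρ ≤ ½`), `dist1 F₂(V)(c) ≤ L·ρ + 23478|S_d|²ℓ²·ρ²` — first order =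
the mean transported-bond mass (`≤ Lρ`), the rest second order (`rem₂ ≤ 7|S_d|ℓρ`); generation 8's crude `dist1_framed₂_le_sup` gave
`71|S_d|ℓρ`. [folklore] -/
theorem dist1_framed₂_le_sharp (hj : j + 1 ≤ P.m + P.K) (V : GaugeField P j (Matrix.specialUnitaryGroup n ℂ)) {ρ : ℝ}
    (hρ : 0 ≤ ρ) (hV : ∀ b, dist1 (V b) ≤ ρ) (hF : 2 * (ell P * ρ) < deltaFed n) (hδ : 12 * Dn P * (ell P * ρ) < deltaSU n)
    (h2 : 12 * Dn P * (ell P * ρ) ≤ 1 / 2) (c : PBond P (j + 1)) :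
    dist1 (framed₂ V c) ≤ P.L * ρ + 23478 * Dn P ^ 2 * (ell P : ℝ) ^ 2 * ρ ^ 2 := by
  have hD := one_le_Dn P
  have hη0 : 0 ≤ ell P * ρ := by have := ell_pos P; positivity
  have hseg : (Fintype.card (Pt P) : ℝ)⁻¹ * ∑ r : Pt P, segMass₁ V c r ≤ P.L * ρ := by
    refine mean_le_of_le fun r => ?_
    refine (walkMass_le_length_mul V hV _).trans (le_of_eq ?_)
    rw [length_walk, List.length_replicate]
  have hs1 : stairMass₂ V c.src ≤ ell P * ρ := mean_le_of_le fun p => walkMass_stair_le V hρ hV _ ⟨p.1, p.2, 1⟩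
  have hs4 : stairMass₂ V c.tgt ≤ ell P * ρ := mean_le_of_le fun p => walkMass_stair_le V hρ hV _ ⟨p.1, p.2, 1⟩
  obtain ⟨_, hs2⟩ := loopRemMean_bounds V hρ hV c
  have hs3 : axMass V c ≤ ell P * ρ := walkMass_ax_le V hρ hV _ _
  have hrem : rem₂ V c ≤ 7 * Dn P * (ell P * ρ) := by unfold rem₂; nlinarith
  have hκ0 : 0 ≤ 3354 * Dn P * (ell P * ρ) := by positivity
  calc dist1 (framed₂ V c)
      ≤ (Fintype.card (Pt P) : ℝ)⁻¹ * ∑ r : Pt P, segMass₁ V c r + 3354 * Dn P * (ell P * ρ) * rem₂ V c :=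
        dist1_framed₂_le hj V hρ hV hF hδ h2 c
    _ ≤ P.L * ρ + 3354 * Dn P * (ell P * ρ) * (7 * Dn P * (ell P * ρ)) := add_le_add hseg (mul_le_mul_of_nonneg_left hrem hκ0)
    _ = P.L * ρ + 23478 * Dn P ^ 2 * (ell P : ℝ) ^ 2 * ρ ^ 2 := by ring

/-! ## §2 The print-kind radii and domains for the two-level prescription -/

/-- THE PRINT-KIND RADIUS AT LEVEL `j` for (0.10)–(0.12): `ρ⁽²⁾_j = r_j(ρ⋆₂∕2)` — base `L`, top radius `ρ⋆₂` (generation 8's `radStar₂`).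
[folklore] -/
def radPK₂ (P : Params) (n : Type*) [Fintype n] (j : ℕ) : ℝ := geomRad P (radStar₂ P n / 2) j

/-- THE PRINT-KIND DOMAIN FAMILY of the two-level analysis. [folklore] -/
def domPK₂ (P : Params) (n : Type*) [Fintype n] [DecidableEq n] [Nonempty n] (j : ℕ) :
    Set (GaugeField P j (Matrix.specialUnitaryGroup n ℂ)) :=
  {V | ∀ b, dist1 (V b) ≤ radPK₂ P n j}

/-- `0 ≤ ρ⋆₂∕2`. [folklore] -/
theorem half_radStar₂_nonneg (P : Params) (n : Type*) [Fintype n] [Nonempty n] : 0 ≤ radStar₂ P n / 2 :=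
  (half_pos (radStar₂_pos P n)).le

/-- `0 ≤ ρ⁽²⁾_j ≤ ρ⋆₂`. [folklore] -/
theorem radPK₂_bounds (P : Params) (n : Type*) [Fintype n] [Nonempty n] (j : ℕ) :
    0 ≤ radPK₂ P n j ∧ radPK₂ P n j ≤ radStar₂ P n := by
  have := geomRad_le_top P (half_radStar₂_nonneg P n) j
  exact ⟨geomRad_nonneg P (half_radStar₂_nonneg P n) j, by unfold radPK₂; linarith⟩

/-- **PRINT KIND**: `ρ⁽²⁾_j ≥ (ρ⋆₂∕2)·L^{−(m+K−j)}`. [cite: Balaban1985Averaging, (158) p.42] -/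
theorem printKind_le_radPK₂ (P : Params) (n : Type*) [Fintype n] [Nonempty n] (j : ℕ) :
    radStar₂ P n / 2 * ((P.L : ℝ)⁻¹) ^ (P.m + P.K - j) ≤ radPK₂ P n j :=
  base_le_geomRad P (half_radStar₂_nonneg P n) j

/-- **THE PRINT-KIND DOMAINS CONTAIN GENERATION 8's two-level ones**: `ρ⋆₂(71|S_d|ℓ)^{−e} ≤ ρ⁽²⁾_j` (`71|S_d|ℓ ≥ 2L`). [folklore] -/
theorem rad₂_le_radPK₂ (P : Params) (n : Type*) [Fintype n] [Nonempty n] (j : ℕ) : rad₂ P n j ≤ radPK₂ P n j := by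
  have hD := one_le_Dn P
  have hr : 2 * (P.L : ℝ) ≤ 71 * Dn P * ell P := by
    have hLℓ : (P.L : ℝ) ≤ ell P := by
      unfold ell; push_cast
      have hL0 : (0 : ℝ) ≤ P.L := Nat.cast_nonneg _
      have hd1 : (1 : ℝ) ≤ P.d := by exact_mod_cast P.hd
      nlinarith
    have hℓ := ell_pos P
    nlinarith
  exact geom_le_geomRad P (radStar₂_pos P n).le hr j

/-- `dom₂_j ⊆ domPK₂_j`. [folklore] -/
theorem dom₂_subset_domPK₂ (j : ℕ) : dom₂ P n j ⊆ domPK₂ P n j := fun _ hV b => (hV b).trans (rad₂_le_radPK₂ P n j)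

/-- The guards on the print-kind two-level domains: `2ℓρ_j < δ_Fed`, `12|S_d|ℓρ_j < δ_N`, `12|S_d|ℓρ_j ≤ ½` (from `ρ_j ≤ ρ⋆₂`, as in
generation 8's `guards₂`). [folklore] -/
theorem guardsPK₂ (P : Params) (n : Type*) [Fintype n] [Nonempty n] (j : ℕ) :
    2 * (ell P * radPK₂ P n j) < deltaFed n ∧ 12 * Dn P * (ell P * radPK₂ P n j) < deltaSU n ∧
      12 * Dn P * (ell P * radPK₂ P n j) ≤ 1 / 2 := by
  have hℓ := ell_pos P; have hD := one_le_Dn P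
  have h1 : 0 < deltaFed n := deltaFed_pos
  have h2 : 0 < deltaSU n := deltaSU_pos
  have h3 : deltaSU n ≤ 1 / 3 := min_le_left _ _
  obtain ⟨hr0, hr⟩ := radPK₂_bounds P n j
  have ha : radPK₂ P n j ≤ deltaFed n / (4 * ell P) := hr.trans ((min_le_left _ _).trans (min_le_left _ _))
  have hb : radPK₂ P n j ≤ deltaSU n / (48 * Dn P * ell P) := hr.trans ((min_le_left _ _).trans (min_le_right _ _))
  have ha' : ell P * radPK₂ P n j ≤ deltaFed n / 4 := by
    calc ell P * radPK₂ P n j ≤ ell P * (deltaFed n / (4 * ell P)) := mul_le_mul_of_nonneg_left ha hℓ.le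
      _ = deltaFed n / 4 := by field_simp
  have hb' : 12 * Dn P * (ell P * radPK₂ P n j) ≤ deltaSU n / 4 := by
    calc 12 * Dn P * (ell P * radPK₂ P n j) ≤ 12 * Dn P * (ell P * (deltaSU n / (48 * Dn P * ell P))) := by gcongr
      _ = deltaSU n / 4 := by field_simp; ring
  exact ⟨by linarith, by linarith, by linarith⟩

/-- The trivial configuration is in every print-kind two-level domain. [folklore] -/
theorem one_mem_domPK₂ (j : ℕ) : (1 : GaugeField P j (Matrix.specialUnitaryGroup n ℂ)) ∈ domPK₂ P n j := fun b => by
  rw [show (1 : GaugeField P j (Matrix.specialUnitaryGroup n ℂ)) b = 1 from rfl, GaugeGroup.dist1_one]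
  exact (radPK₂_bounds P n j).1

/-- `23478|S_d|²ℓ²·(ρ⋆₂∕2) ≤ ⅛` — from generation 8's `ρ⋆₂ ≤ θ∕(2K₂)`, `K₂ = 46956d|S_d|²ℓ²`, `θ ≤ 1`, `d ≥ 1`. [folklore] -/
theorem quadCoeff₂_small (P : Params) (n : Type*) [Fintype n] [Nonempty n] :
    23478 * Dn P ^ 2 * (ell P : ℝ) ^ 2 * (radStar₂ P n / 2) ≤ 1 / 8 := by
  have hℓ := ell_pos P; have hD := one_le_Dn P
  have hθ := theta_le_one P
  have hθ0 := theta_pos P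
  have hd : (1 : ℝ) ≤ P.d := by exact_mod_cast P.hd
  have hK : radStar₂ P n ≤ theta P / (2 * K2 P) := min_le_right _ _
  have hK' : 23478 * Dn P ^ 2 * (ell P : ℝ) ^ 2 * radStar₂ P n ≤ 23478 * Dn P ^ 2 * (ell P : ℝ) ^ 2 * (theta P / (2 * K2 P)) :=
    mul_le_mul_of_nonneg_left hK (by positivity)
  have he : 23478 * Dn P ^ 2 * (ell P : ℝ) ^ 2 * (theta P / (2 * K2 P)) = theta P / (4 * P.d) := by
    unfold K2
    field_simp
    ring
  have hq : theta P / (4 * P.d) ≤ 1 / 4 := by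
    rw [div_le_iff₀ (by positivity)]
    nlinarith
  linarith

/-- **THE BOOTSTRAP STEP FOR (0.10)–(0.12)**: `L·ρ⁽²⁾_j + 23478|S_d|²ℓ²·(ρ⁽²⁾_j)² ≤ ρ⁽²⁾_{j+1}` in the standing range. [folklore] -/
theorem radPK₂_step (P : Params) (n : Type*) [Fintype n] [Nonempty n] {j : ℕ} (hj : j + 1 ≤ P.m + P.K) :
    (P.L : ℝ) * radPK₂ P n j + 23478 * Dn P ^ 2 * (ell P : ℝ) ^ 2 * radPK₂ P n j ^ 2 ≤ radPK₂ P n (j + 1) :=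
  geomRad_step P (half_radStar₂_nonneg P n) (by positivity) (quadCoeff₂_small P n) hj

/-- THE PRINT-KIND TWO-LEVEL RADII SUM TO AT MOST `ρ⋆₂` along any stretch of levels. [folklore] -/
theorem sum_radPK₂_le (P : Params) (n : Type*) [Fintype n] [Nonempty n] {k n' : ℕ} (hkn : k + n' ≤ P.m + P.K) :
    ∑ i ∈ range n', radPK₂ P n (k + i) ≤ radStar₂ P n := by
  have := sum_geomRad_le P (half_radStar₂_nonneg P n) hkn
  unfold radPK₂; linarith

/-! ## §3 The tower for the two-level prescription on the print-kind domains -/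

/-- **`FlatStepContraction` FOR THE TWO-LEVEL PRESCRIPTION ON `SU(N)` ON THE PRINT-KIND DOMAINS**, factors `θ + K₂ρ⁽²⁾_j`. [folklore] -/
theorem flatStepContraction_blockAvg₂SU_printKind :
    FlatStepContraction (fun j => (blockAvg₂ (federbushSU (n := n)) (expMeanLogSU (n := n)) :
      Averaging P j (Matrix.specialUnitaryGroup n ℂ))) (domPK₂ P n) (fun j => theta P + K2 P * radPK₂ P n j) := by
  intro j hj V hV
  obtain ⟨hF, hδ, h2⟩ := guardsPK₂ P n j
  have hρ := (radPK₂_bounds P n j).1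
  refine ⟨frameTransf₂ V, fun c => ?_, ?_⟩
  · show dist1 (framed₂ V c) ≤ radPK₂ P n (j + 1)
    exact (dist1_framed₂_le_sharp hj V hρ hV hF hδ h2 c).trans (radPK₂_step P n hj)
  · show tv 1 (framed₂ V) ≤ (theta P + K2 P * radPK₂ P n j) * tv 1 V
    exact tv_framed₂_le hj V hρ hV hF hδ h2

/-- THE LEVEL FACTORS COMPOSE TO `e·θⁿ` on the print-kind two-level domains. [folklore] -/
theorem prod_factorPK₂_le (P : Params) (n : Type*) [Fintype n] [Nonempty n] {k n' : ℕ} (hkn : k + n' ≤ P.m + P.K) :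
    ∏ i ∈ range n', (theta P + K2 P * radPK₂ P n (k + i)) ≤ Real.exp 1 * theta P ^ n' := by
  have hθ := theta_pos P
  have hK := K2_pos P
  have hfac : ∀ i ∈ range n', theta P + K2 P * radPK₂ P n (k + i) ≤ theta P * Real.exp (K2 P / theta P * radPK₂ P n (k + i)) := by
    intro i _
    have h1 := Real.add_one_le_exp (K2 P / theta P * radPK₂ P n (k + i))
    have hθinv : theta P * (theta P)⁻¹ = 1 := mul_inv_cancel₀ hθ.ne'
    have e : theta P * (K2 P / theta P * radPK₂ P n (k + i) + 1) = theta P + K2 P * radPK₂ P n (k + i) := by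
      rw [div_eq_mul_inv]
      linear_combination (K2 P * radPK₂ P n (k + i)) * hθinv
    calc theta P + K2 P * radPK₂ P n (k + i) = theta P * (K2 P / theta P * radPK₂ P n (k + i) + 1) := e.symm
      _ ≤ theta P * Real.exp (K2 P / theta P * radPK₂ P n (k + i)) := mul_le_mul_of_nonneg_left h1 hθ.le
  have hpos : ∀ i ∈ range n', 0 ≤ theta P + K2 P * radPK₂ P n (k + i) := fun i _ =>
    add_nonneg hθ.le (mul_nonneg hK.le (radPK₂_bounds P n _).1)
  have hsum : ∑ i ∈ range n', K2 P / theta P * radPK₂ P n (k + i) ≤ 1 := by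
    rw [← Finset.mul_sum]
    calc K2 P / theta P * ∑ i ∈ range n', radPK₂ P n (k + i) ≤ K2 P / theta P * radStar₂ P n :=
          mul_le_mul_of_nonneg_left (sum_radPK₂_le P n hkn) (by positivity)
      _ ≤ K2 P / theta P * (theta P / (2 * K2 P)) := mul_le_mul_of_nonneg_left (min_le_right _ _) (by positivity)
      _ = 1 / 2 := by
          rw [div_mul_div_comm, div_eq_iff (by positivity)]
          ring
      _ ≤ 1 := by norm_num
  calc ∏ i ∈ range n', (theta P + K2 P * radPK₂ P n (k + i))
      ≤ ∏ i ∈ range n', theta P * Real.exp (K2 P / theta P * radPK₂ P n (k + i)) := Finset.prod_le_prod hpos hfac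
    _ = theta P ^ n' * Real.exp (∑ i ∈ range n', K2 P / theta P * radPK₂ P n (k + i)) := by
        rw [Finset.prod_mul_distrib, Finset.prod_const, Finset.card_range, Real.exp_sum]
    _ ≤ theta P ^ n' * Real.exp 1 := by gcongr
    _ = Real.exp 1 * theta P ^ n' := mul_comm _ _

/-- **`BondDevBound (blockAvg₂ federbushSU expMeanLogSU) domPK₂ e θ`** — TWO-LEVEL prescription, print-kind domains. [folklore] -/
theorem bondDevBound_blockAvg₂SU_printKind :
    BondDevBound (fun j => (blockAvg₂ (federbushSU (n := n)) (expMeanLogSU (n := n)) :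
      Averaging P j (Matrix.specialUnitaryGroup n ℂ))) (domPK₂ P n) (Real.exp 1) (theta P) :=
  bondDevBound_of_flatStepContraction flatStepContraction_blockAvg₂SU_printKind
    (fun j => add_nonneg (theta_nonneg P) (mul_nonneg (K2_pos P).le (radPK₂_bounds P n j).1))
    fun _ _ hkn => prod_factorPK₂_le P n hkn

/-- **`HolDevBound (blockAvg₂ federbushSU expMeanLogSU) domPK₂ e θ`**. [folklore] -/
theorem holDevBound_blockAvg₂SU_printKind :
    HolDevBound (fun j => (blockAvg₂ (federbushSU (n := n)) (expMeanLogSU (n := n)) :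
      Averaging P j (Matrix.specialUnitaryGroup n ℂ))) (domPK₂ P n) (Real.exp 1) (theta P) :=
  holDevBound_of_bondDevBound bondDevBound_blockAvg₂SU_printKind

/-- **`LoopDefectBound (blockAvg₂ federbushSU expMeanLogSU) domPK₂ (e²/2) θ`** (criticality on `SU(N)`). [folklore] -/
theorem loopDefectBound_blockAvg₂SU_printKind :
    LoopDefectBound (fun j => (blockAvg₂ (federbushSU (n := n)) (expMeanLogSU (n := n)) :
      Averaging P j (Matrix.specialUnitaryGroup n ℂ))) (domPK₂ P n) (1 / 2 * Real.exp 1 ^ 2) (theta P) :=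
  loopDefectBound_of_holDevBound reTrCrit_specialUnitaryGroup (by norm_num) holDevBound_blockAvg₂SU_printKind

/-- Generation 8's `holDevBound_blockAvg₂SU` (domains `dom₂`, base `71|S_d|ℓ`) is a COROLLARY (`dom₂ ⊆ domPK₂`, `HolDevBound.anti`).
[folklore] -/
theorem holDevBound_blockAvg₂SU_of_printKind :
    HolDevBound (fun j => (blockAvg₂ (federbushSU (n := n)) (expMeanLogSU (n := n)) :
      Averaging P j (Matrix.specialUnitaryGroup n ℂ))) (dom₂ P n) (Real.exp 1) (theta P) :=
  holDevBound_blockAvg₂SU_printKind.anti fun j => dom₂_subset_domPK₂ j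

/-- THE COMMON PRINT-KIND DOMAIN FAMILY for the two printed prescriptions: `domPK ∩ domPK₂` — sup-balls of radius
`min(ρ_j, ρ⁽²⁾_j) ≥ (min(ρ⋆, ρ⋆₂)∕2)·L^{−(m+K−j)}`, print kind. [folklore] -/
def domPrintedPK (P : Params) (n : Type*) [Fintype n] [DecidableEq n] [Nonempty n] (j : ℕ) :
    Set (GaugeField P j (Matrix.specialUnitaryGroup n ℂ)) :=
  domPK P n j ∩ domPK₂ P n j

/-- Generation 8's common family is contained in the print-kind one: `domPrinted_j ⊆ domPrintedPK_j`. [folklore] -/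
theorem domPrinted_subset_domPrintedPK (j : ℕ) : domPrinted P n j ⊆ domPrintedPK P n j :=
  Set.inter_subset_inter (dom_subset_domPK j) (dom₂_subset_domPK₂ j)

/-- The trivial configuration is in every common print-kind domain. [folklore] -/
theorem one_mem_domPrintedPK (j : ℕ) : (1 : GaugeField P j (Matrix.specialUnitaryGroup n ℂ)) ∈ domPrintedPK P n j :=
  ⟨one_mem_domPK j, one_mem_domPK₂ j⟩

end SUN

/-! ## §4 The headline's printed class — one-level, two-level, and both disjuncts — on the print-kind domains -/

section Headline

open Literature.MathematicalPhysics.QuantumFieldTheory.Balaban1983to89.T4Continuum.FiniteEpsData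

variable {F : T4Family} {N : ℕ} [NeZero N]

/-- **ONE-LEVEL CLASS** (`D.IsPrintedAveraged₁`): `HolDevBound` for the datum's own averaging maps `D.av K` at every cutoff, rate
`θ = L^{1−d}`, constant `e`, ON THE PRINT-KIND DOMAINS `domPK` (file 51's tower). [folklore] -/
theorem holDevBound_of_isPrintedAveraged₁_printKind (D : FiniteEpsData F (Matrix.specialUnitaryGroup (Fin N) ℂ))
    (hD : D.IsPrintedAveraged₁) (K : ℕ) :
    HolDevBound (D.av K) (domPK (F.P K) (Fin N)) (Real.exp 1) (theta (F.P K)) := by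
  have h : D.av K = fun j => blockAvg (expMeanLogSU (n := Fin N)) := funext fun j => hD K j
  rw [h]
  exact holDevBound_blockAvgSU_printKind

/-- **TWO-LEVEL CLASS** (`D.IsPrintedAveraged₂`): `HolDevBound` for the datum's own averaging maps on `domPK₂`. [folklore] -/
theorem holDevBound_of_isPrintedAveraged₂_printKind (D : FiniteEpsData F (Matrix.specialUnitaryGroup (Fin N) ℂ))
    (hD : D.IsPrintedAveraged₂) (K : ℕ) :
    HolDevBound (D.av K) (domPK₂ (F.P K) (Fin N)) (Real.exp 1) (theta (F.P K)) := by
  have h : D.av K = fun j => blockAvg₂ (federbushSU (n := Fin N)) (expMeanLogSU (n := Fin N)) := funext fun j => hD K j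
  rw [h]
  exact holDevBound_blockAvg₂SU_printKind

/-- **NODE S's HOLONOMY-LEVEL INPUT FOR THE HEADLINE'S CLASS, BOTH DISJUNCTS, ON PRINT-KIND DOMAINS**: for every finite-`ε` datum
`D` over `SU(N)` with `D.IsPrintedAveraged` — the exact hypothesis `hD` of `T4ContinuumYM4Torus.continuumYM4_torus_of_BetaPertH`
([Balaban1987RG1] (0.4) OR (0.10)–(0.12) with the printed means) — and every cutoff `K`,
`HolDevBound (D.av K) domPrintedPK e θ`, `θ = L^{1−d}`, on sup-balls shrinking by the factor `L` per level (base `L`, the kind of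
[Balaban1985Averaging] (158)).  Generation 8's `holDevBound_of_isPrintedAveraged` (base `16ℓ` ∕ `71|S_d|ℓ`) follows by `anti`.
[folklore] -/
theorem holDevBound_of_isPrintedAveraged_printKind (D : FiniteEpsData F (Matrix.specialUnitaryGroup (Fin N) ℂ))
    (hD : D.IsPrintedAveraged) (K : ℕ) :
    HolDevBound (D.av K) (domPrintedPK (F.P K) (Fin N)) (Real.exp 1) (theta (F.P K)) := by
  rcases hD with h1 | h2
  · exact (holDevBound_of_isPrintedAveraged₁_printKind D h1 K).anti fun j => Set.inter_subset_left
  · exact (holDevBound_of_isPrintedAveraged₂_printKind D h2 K).anti fun j => Set.inter_subset_right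

/-- … and generation 3's `LoopDefectBound` (constant `e²/2`) for the datum's own averaging maps, whole printed class, print-kind
domains: `0 ≤ 1 − W(avgⁿ V) ≤ (e²/2)·(|w|·tv(1,V)·θⁿ)²`. [folklore] -/
theorem loopDefectBound_of_isPrintedAveraged_printKind (D : FiniteEpsData F (Matrix.specialUnitaryGroup (Fin N) ℂ))
    (hD : D.IsPrintedAveraged) (K : ℕ) :
    LoopDefectBound (D.av K) (domPrintedPK (F.P K) (Fin N)) (1 / 2 * Real.exp 1 ^ 2) (theta (F.P K)) :=
  loopDefectBound_of_holDevBound reTrCrit_specialUnitaryGroup (by norm_num) (holDevBound_of_isPrintedAveraged_printKind D hD K)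

/-- Generation 8's full-class statement on `domPrinted` is a corollary of the print-kind one. [folklore] -/
theorem holDevBound_of_isPrintedAveraged_of_printKind (D : FiniteEpsData F (Matrix.specialUnitaryGroup (Fin N) ℂ))
    (hD : D.IsPrintedAveraged) (K : ℕ) :
    HolDevBound (D.av K) (domPrinted (F.P K) (Fin N)) (Real.exp 1) (theta (F.P K)) :=
  (holDevBound_of_isPrintedAveraged_printKind D hD K).anti fun j => domPrinted_subset_domPrintedPK j

end Headline

end Summit.QuantumFields.BalabanUV.T4Continuum.Spine.NE7

end
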